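import Summits.Ventures.HSemireg.PhaseTorusLawE8

/-!
# Box-hosted sets on the phase torus `(μ₄)⁴`: the BOX-HOSTED LAW (any cardinality), the 8-set dichotomy STATEMENT with corank 8 as a
# consequence, and the hosting bookkeeping of a NON-hosted set of `≤ 8` phases: every complementary pair catches exactly `4` points,
# every box exactly `2`, box partners are OPPOSITE elsewhere (HSemireg support file; phase-torus line, corank threshold, module 3 of 4)

Crux of record: `Summit.HodgeConjecture.HodgeConjecture.Theses.EightfoldBlochSeeds.BlochSeedDiscOne`
(= `HasHyperbolicBlochSeed 4 1`, item stmt-HodgeConjecture-18881; skeleton `Lines/birth.lean`, STUB R `stub_rung_pad4_seedAt`,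
named technique = PAD-4 two-level ⊕-block design with a TWO-TERM line-bundle presentation).
Nothing in this file proves HC, HC_AV, HC_CM, H2 or item 18881; census-neutral (no SAT∕UNSAT row is added or changed).

WHAT THIS FILE IS (tree copy of §6, §7.1, §7.2 of the crux workfile `Cruxes/BlochSeedDiscOne/PhaseTorusLawAllCoranks.lean`
b3a30e3be1a62a1c, author s4-prove-2 g0, director-hodge R19.171 block F1; statements verbatim; pen: `PHASE-TORUS-ALLCORANK-s4p2.md`):
* §6 `BoxHosted A f₀ s` (a free coordinate `f₀` and an adjacent pair `{s f, s f + 1}` on every other coordinate catch all of `A`),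
  the BOX-HOSTED LAW `BoxLaw` (hosted positive set of ANY cardinality ⇒ `μ = 0`) and **`boxLaw_holds`** (the four rotations of
  `PhaseTorusLawProof.rot_step`, exactly as `phaseTorusLaw_holds` with the covering step replaced by the hypothesis; the same theorem,
  unbundled, is `Pad4TowerLineStaticSpread`'s `PhaseTorus.boxLaw` — kept here in named form at torus level so that torus files need not
  import the design tower); the dichotomy STATEMENT `EightDichotomy` (every set of `≤ 8` phases is box-hosted or inside an `E8`-coset)
  and **`phaseTorusLawN_eight_of_dichotomy`** (box-hosted law + `PhaseTorusLawE8.e8Law`); `threshold_summary`.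
* §7.1 hosting bookkeeping: `unhosted B g s` (points escaping the pair `{s, s+1}` at `g`), double counting `Σ_s |unhosted B g s| = 2|B|`,
  `boxHosted_of_three`, `host_le_one`, `host_le_three` (from `PhaseTorusLaw7.exists_half_host`), the `box` over two adjacent pairs.
* §7.2 STRUCTURE of a non-hosted `A` with `|A| ≤ 8` (section hypotheses `hA8`, `hN`): every complementary pair catches exactly `4`
  points (`card_unhosted`), `|A| = 8` (`card_eq_eight`), every box holds exactly `2` points (`card_box`), and two points of a box are
  OPPOSITE on the two remaining coordinates (`opp_of_box`); `exists_partner`.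
Everything here is PROVED (axioms `propext`, `Classical.choice`, `Quot.sound`; no `sorry`, no named fact, no instance, no notation).

WHAT IT IS NOT: a statement about sheaves, monads, a SOURCE or a SEED.  The dichotomy itself (`eightDichotomy_holds`: all differences of
a non-hosted 8-set lie in `E8`) and `phaseTorusLaw8_holds` are the sequel `PhaseTorusLawEight`.
Tree filing: hsemireg-phasetorus-typer-1 g2.
-/

namespace Summit.Ventures.HSemireg.PhaseTorus

open Finset BigOperators


/-- `A` is BOX-HOSTED: a free coordinate `f₀` and an adjacent pair `{s f, s f + 1}` on every other coordinate catch all of `A`. -/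
def BoxHosted (A : Finset PT) (f₀ : Fin 4) (s : Fin 4 → ZMod 4) : Prop :=
  ∀ a ∈ A, ∃ f, f ≠ f₀ ∧ (a f = s f ∨ a f = s f + 1)

/-- the BOX-HOSTED LAW: box-hosted positive set (ANY cardinality) ⇒ `μ = 0` (unbundled: `PhaseTorus.boxLaw` of `Pad4TowerLineStaticSpread`). -/
def BoxLaw : Prop :=
  ∀ (ω : PT → ℝ) (A : Finset PT) (f₀ : Fin 4) (s : Fin 4 → ZMod 4), BoxHosted A f₀ s →
    (∀ τ, τ ∉ A → ω τ ≤ 0) → (∀ k, KAdm k → moment ω k = 0) → moment ω (fun _ => 1) = 0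

/-- **the box-hosted law holds** (`PhaseTorusLawProof.rot_step` for a general free coordinate `f₀` + the four rotations; no cardinality anywhere). -/
theorem boxLaw_holds : BoxLaw := by
  intro ω A f₀ s hbox hω hK
  set P : ℂ := ∏ f ∈ Finset.univ.erase f₀, (starRingEnd ℂ) (zPair (s f)) / 2 with hP
  have hPne : P ≠ 0 := Finset.prod_ne_zero_iff.2 fun f _ =>
    div_ne_zero ((map_ne_zero _).2 (zPair_ne_zero _)) (by norm_num)
  have key : ∀ w : ZMod 4, (e (-w) * (P * moment ω (fun _ => 1) / 4)).re ≤ 0 := by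
    intro w
    have h := rot_step ω A hω hK f₀ s hbox w
    rw [prod_cvec_one] at h
    have hrw : e (-w) / 4 * P * moment ω (fun _ => 1) = e (-w) * (P * moment ω (fun _ => 1) / 4) := by ring
    rw [hrw] at h
    exact h
  have hz : P * moment ω (fun _ => 1) / 4 = 0 := by
    apply eq_zero_of_re_rot_nonpos
    · have := key 0; rwa [neg_zero, e_zero] at this
    · have := key 3; rwa [show (-3 : ZMod 4) = 1 from by decide, e_one] at this
    · have := key 2; rwa [show (-2 : ZMod 4) = 2 from by decide, e_two] at this
    · have := key 1; rwa [show (-1 : ZMod 4) = 3 from by decide, e_three] at this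
  have h4 : (4 : ℂ) ≠ 0 := by norm_num
  rcases mul_eq_zero.1 ((div_eq_zero_iff.1 hz).resolve_right h4) with h | h
  · exact absurd h hPne
  · exact h

/-- **THE 8-SET DICHOTOMY** (finite combinatorics of `(ℤ/4)⁴`; PROVED below, `eightDichotomy_holds`, §7; also verified by exhaustive
enumeration `py/tiling8.py` + `py/cliques.py`: the non-hosted 8-sets are exactly the 32 cosets of `E8`): every set of at most 8 phases is
box-hosted or lies in an E8-coset. -/
def EightDichotomy : Prop :=
  ∀ A : Finset PT, A.card ≤ 8 → (∃ f₀ s, BoxHosted A f₀ s) ∨ (∃ c, A ⊆ e8Set.image (· + c))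

/-- **corank 8**: the phase-torus law holds at corank `≤ 8`, given the 8-set dichotomy (box law + E8 law, both kernel). -/
theorem phaseTorusLawN_eight_of_dichotomy (hdich : EightDichotomy) : PhaseTorusLawN 8 := by
  intro ω A hA hω hK
  rcases hdich A hA with ⟨f₀, s, hhost⟩ | ⟨c, hc⟩
  · exact boxLaw_holds ω A f₀ s hhost hω hK
  · exact e8Law ω c (fun τ hτ => hω τ fun ha => hτ (hc ha)) hK

/-- threshold summary from a dichotomy hypothesis (kept for the record; see `phaseTorusLaw8_holds`, `threshold_kernel` below for the
unconditional statements). -/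
theorem threshold_summary (hdich : EightDichotomy) :
    PhaseTorusLawN 7 ∧ PhaseTorusLawN 8 ∧ ¬ PhaseTorusLawN 16 ∧ ¬ PhaseTorusLawAll :=
  ⟨phaseTorusLawN_seven, phaseTorusLawN_eight_of_dichotomy hdich, not_phaseTorusLawN_sixteen, not_phaseTorusLawAll⟩

/-! ## §7 Towards the 8-set dichotomy: non-hosted sets of `≤ 8` phases

Pen route (no enumeration): greedy hosting counts force every complementary pair to catch exactly 4 points and every box exactly 2,
the two points of a box being OPPOSITE on the remaining coordinates (else a host exists); then (sequel) an odd difference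
`b_g = a_g + 1`, or an even difference of odd weight, produces two points agreeing on two coordinates but not opposite on a third. -/

/-! ### §7.1 Hosting bookkeeping -/

/-- the points of `B` NOT hosted by the adjacent pair `{s, s+1}` on coordinate `g`. -/
def unhosted (B : Finset PT) (g : Fin 4) (s : ZMod 4) : Finset PT := B.filter fun a => ¬(a g = s ∨ a g = s + 1)

/-- membership in `unhosted`. -/
theorem mem_unhosted {B : Finset PT} {g : Fin 4} {s : ZMod 4} {a : PT} :
    a ∈ unhosted B g s ↔ a ∈ B ∧ ¬(a g = s ∨ a g = s + 1) := Finset.mem_filter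

/-- double counting: every value of `ℤ/4` escapes exactly two of the four adjacent pairs. -/
theorem sum_card_unhosted (B : Finset PT) (g : Fin 4) : ∑ s : ZMod 4, (unhosted B g s).card = 2 * B.card := by
  have hcount : ∀ v : ZMod 4, (Finset.univ.filter (fun s : ZMod 4 => ¬(v = s ∨ v = s + 1))).card = 2 := by decide
  unfold unhosted
  simp only [Finset.card_filter]
  rw [Finset.sum_comm]
  simp only [← Finset.card_filter, hcount]
  simp [Finset.sum_const, mul_comm]

/-- a fourth coordinate off three given ones. -/
theorem exists_fourth (g₁ g₂ g₃ : Fin 4) : ∃ f₀ : Fin 4, f₀ ≠ g₁ ∧ f₀ ≠ g₂ ∧ f₀ ≠ g₃ := by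
  revert g₁ g₂ g₃; decide

/-- two further distinct coordinates off a given one. -/
theorem exists_two_others (g₁ : Fin 4) : ∃ g₂ g₃ : Fin 4, g₂ ≠ g₁ ∧ g₃ ≠ g₁ ∧ g₂ ≠ g₃ := by
  revert g₁; decide

/-- a third coordinate off two given ones. -/
theorem exists_other (g₁ g₂ : Fin 4) : ∃ g₃ : Fin 4, g₃ ≠ g₁ ∧ g₃ ≠ g₂ := by
  revert g₁ g₂; decide

/-- assembling a box host from three hosting pairs on three distinct coordinates. -/
theorem boxHosted_of_three (A : Finset PT) {g₁ g₂ g₃ : Fin 4} (h12 : g₁ ≠ g₂) (h13 : g₁ ≠ g₃) (h23 : g₂ ≠ g₃)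
    (s₁ s₂ s₃ : ZMod 4)
    (H : ∀ a ∈ A, (a g₁ = s₁ ∨ a g₁ = s₁ + 1) ∨ (a g₂ = s₂ ∨ a g₂ = s₂ + 1) ∨ (a g₃ = s₃ ∨ a g₃ = s₃ + 1)) :
    ∃ f₀ s, BoxHosted A f₀ s := by
  obtain ⟨f₀, h01, h02, h03⟩ := exists_fourth g₁ g₂ g₃
  refine ⟨f₀, fun f => if f = g₁ then s₁ else if f = g₂ then s₂ else s₃, fun a ha => ?_⟩
  rcases H a ha with h | h | h
  · exact ⟨g₁, fun e => h01 e.symm, by simpa using h⟩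
  · exact ⟨g₂, fun e => h02 e.symm, by simpa [h12.symm] using h⟩
  · exact ⟨g₃, fun e => h03 e.symm, by simpa [h13.symm, h23.symm] using h⟩

/-- a set of `≤ 1` points is hosted on any coordinate. -/
theorem host_le_one (B : Finset PT) (hB : B.card ≤ 1) (g : Fin 4) : ∃ s : ZMod 4, ∀ a ∈ B, a g = s ∨ a g = s + 1 := by
  obtain ⟨s, hs⟩ := exists_half_host B g
  refine ⟨s, fun a ha => ?_⟩
  by_contra hn
  have hmem : a ∈ B.filter (fun a => ¬(a g = s ∨ a g = s + 1)) := Finset.mem_filter.2 ⟨ha, hn⟩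
  have hpos : 0 < (B.filter (fun a => ¬(a g = s ∨ a g = s + 1))).card := Finset.card_pos.2 ⟨a, hmem⟩
  omega

/-- a set of `≤ 3` points is hosted on any two coordinates. -/
theorem host_le_three (B : Finset PT) (hB : B.card ≤ 3) (g₂ g₃ : Fin 4) :
    ∃ s₂ s₃ : ZMod 4, ∀ a ∈ B, (a g₂ = s₂ ∨ a g₂ = s₂ + 1) ∨ (a g₃ = s₃ ∨ a g₃ = s₃ + 1) := by
  obtain ⟨s₂, hs₂⟩ := exists_half_host B g₂
  have h1 : (B.filter (fun a => ¬(a g₂ = s₂ ∨ a g₂ = s₂ + 1))).card ≤ 1 := by omega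
  obtain ⟨s₃, hs₃⟩ := host_le_one _ h1 g₃
  refine ⟨s₂, s₃, fun a ha => ?_⟩
  by_cases h : a g₂ = s₂ ∨ a g₂ = s₂ + 1
  · exact Or.inl h
  · exact Or.inr (hs₃ a (Finset.mem_filter.2 ⟨ha, h⟩))


/-- `x ∈ {x + 3, x + 3 + 1}` (the pair just below `x`). -/
theorem mem_pair_pred (x : ZMod 4) : x = x + 3 ∨ x = x + 3 + 1 := by revert x; decide

/-- `x + 3 + 1 = x` in `ℤ/4`. -/
theorem add_three_add_one (x : ZMod 4) : x + 3 + 1 = x := by revert x; decide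

/-- complementary pairs are pairs: `¬(x ∈ {t+2, t+3}) ↔ x ∈ {t, t+1}`. -/
theorem not_far_iff (x t : ZMod 4) : ¬(x = t + 2 ∨ x = t + 2 + 1) ↔ (x = t ∨ x = t + 1) := by
  revert x t; decide

/-- the BOX of `A` over the adjacent pairs `{t₁, t₁+1}` at `g₁` and `{t₂, t₂+1}` at `g₂`. -/
def box (A : Finset PT) (g₁ : Fin 4) (t₁ : ZMod 4) (g₂ : Fin 4) (t₂ : ZMod 4) : Finset PT :=
  A.filter fun a => (a g₁ = t₁ ∨ a g₁ = t₁ + 1) ∧ (a g₂ = t₂ ∨ a g₂ = t₂ + 1)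

/-- membership in a `box`. -/
theorem mem_box {A : Finset PT} {g₁ g₂ : Fin 4} {t₁ t₂ : ZMod 4} {a : PT} :
    a ∈ box A g₁ t₁ g₂ t₂ ↔ a ∈ A ∧ (a g₁ = t₁ ∨ a g₁ = t₁ + 1) ∧ (a g₂ = t₂ ∨ a g₂ = t₂ + 1) := Finset.mem_filter

/-- a box is a doubly complementary `unhosted` set. -/
theorem box_eq_unhosted₂ (A : Finset PT) (g₁ : Fin 4) (t₁ : ZMod 4) (g₂ : Fin 4) (t₂ : ZMod 4) :
    box A g₁ t₁ g₂ t₂ = unhosted (unhosted A g₁ (t₁ + 2)) g₂ (t₂ + 2) := by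
  ext a
  simp only [mem_box, mem_unhosted, not_far_iff, and_assoc]

/-! ### §7.2 Structure of a non-hosted set of at most 8 phases -/

section structure_

variable {A : Finset PT} (hA8 : A.card ≤ 8) (hN : ∀ (f₀ : Fin 4) (s : Fin 4 → ZMod 4), ¬ BoxHosted A f₀ s)
include hA8 hN

omit hA8 in
/-- every complementary pair catches at least 4 points … -/
theorem four_le_card_unhosted (g : Fin 4) (s : ZMod 4) : 4 ≤ (unhosted A g s).card := by
  by_contra hlt
  have h3 : (unhosted A g s).card ≤ 3 := by omega
  obtain ⟨g₂, g₃, h21, h31, h23⟩ := exists_two_others g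
  obtain ⟨s₂, s₃, hh⟩ := host_le_three _ h3 g₂ g₃
  obtain ⟨f₀, t, ht⟩ := boxHosted_of_three A (Ne.symm h21) (Ne.symm h31) h23 s s₂ s₃ fun a ha => by
    by_cases h : a g = s ∨ a g = s + 1
    · exact Or.inl h
    · exact Or.inr (hh a (mem_unhosted.2 ⟨ha, h⟩))
  exact hN f₀ t ht

/-- … hence exactly 4, and `|A| = 8`. -/
theorem card_unhosted (g : Fin 4) (s : ZMod 4) : (unhosted A g s).card = 4 := by
  have hsum := sum_card_unhosted A g
  rw [sum_univ_zmod4] at hsum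
  have h0 := four_le_card_unhosted hN g 0
  have h1 := four_le_card_unhosted hN g 1
  have h2 := four_le_card_unhosted hN g 2
  have h3 := four_le_card_unhosted hN g 3
  have := four_le_card_unhosted hN g s
  rcases (by decide : ∀ x : ZMod 4, x = 0 ∨ x = 1 ∨ x = 2 ∨ x = 3) s with rfl | rfl | rfl | rfl <;> omega

/-- … and `|A| = 8`. -/
theorem card_eq_eight : A.card = 8 := by
  have hsum := sum_card_unhosted A 0
  rw [sum_univ_zmod4] at hsum
  have h0 := card_unhosted hA8 hN 0 0
  have h1 := card_unhosted hA8 hN 0 1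
  have h2 := card_unhosted hA8 hN 0 2
  have h3 := card_unhosted hA8 hN 0 3
  omega

/-- the doubly complementary box catches exactly 2 points. -/
theorem card_unhosted₂ {g₁ g₂ : Fin 4} (hg : g₁ ≠ g₂) (s₁ s₂ : ZMod 4) :
    (unhosted (unhosted A g₁ s₁) g₂ s₂).card = 2 := by
  have hge : ∀ t : ZMod 4, 2 ≤ (unhosted (unhosted A g₁ s₁) g₂ t).card := by
    intro t
    by_contra hlt
    have h1 : (unhosted (unhosted A g₁ s₁) g₂ t).card ≤ 1 := by omega
    obtain ⟨g₃, h31, h32⟩ := exists_other g₁ g₂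
    obtain ⟨s₃, hs₃⟩ := host_le_one _ h1 g₃
    obtain ⟨f₀, u, hu⟩ := boxHosted_of_three A hg (Ne.symm h31) (Ne.symm h32) s₁ t s₃ fun a ha => by
      by_cases c1 : a g₁ = s₁ ∨ a g₁ = s₁ + 1
      · exact Or.inl c1
      by_cases c2 : a g₂ = t ∨ a g₂ = t + 1
      · exact Or.inr (Or.inl c2)
      exact Or.inr (Or.inr (hs₃ a (mem_unhosted.2 ⟨mem_unhosted.2 ⟨ha, c1⟩, c2⟩)))
    exact hN f₀ u hu
  have hsum := sum_card_unhosted (unhosted A g₁ s₁) g₂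
  rw [sum_univ_zmod4, card_unhosted hA8 hN g₁ s₁] at hsum
  have h0 := hge 0; have h1 := hge 1; have h2 := hge 2; have h3 := hge 3
  have := hge s₂
  rcases (by decide : ∀ x : ZMod 4, x = 0 ∨ x = 1 ∨ x = 2 ∨ x = 3) s₂ with rfl | rfl | rfl | rfl <;> omega

/-- **every box holds exactly two points of `A`.** -/
theorem card_box {g₁ g₂ : Fin 4} (hg : g₁ ≠ g₂) (t₁ t₂ : ZMod 4) : (box A g₁ t₁ g₂ t₂).card = 2 := by
  rw [box_eq_unhosted₂ A]; exact card_unhosted₂ hA8 hN hg _ _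

/-- **two distinct points in a common box are OPPOSITE on the two remaining coordinates.** -/
theorem opp_of_box {g₁ g₂ : Fin 4} (hg : g₁ ≠ g₂) (t₁ t₂ : ZMod 4) {a b : PT}
    (ha : a ∈ box A g₁ t₁ g₂ t₂) (hb : b ∈ box A g₁ t₁ g₂ t₂) (hab : a ≠ b)
    (g₃ : Fin 4) (h31 : g₃ ≠ g₁) (h32 : g₃ ≠ g₂) : b g₃ = a g₃ + 2 := by
  by_contra hne
  -- the box is {a, b}
  have hbox : ∀ c ∈ box A g₁ t₁ g₂ t₂, c = a ∨ c = b := by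
    intro c hc
    by_contra hc'
    push Not at hc'
    have h3 : 3 ≤ (box A g₁ t₁ g₂ t₂).card := by
      have : ({a, b, c} : Finset PT) ⊆ box A g₁ t₁ g₂ t₂ := by
        intro x hx; simp only [Finset.mem_insert, Finset.mem_singleton] at hx
        rcases hx with rfl | rfl | rfl <;> assumption
      have hc3 : ({a, b, c} : Finset PT).card = 3 := by
        rw [Finset.card_insert_of_notMem, Finset.card_pair (Ne.symm hc'.2)]
        simp [hab, Ne.symm hc'.1]
      exact hc3 ▸ Finset.card_le_card this
    have := card_box hA8 hN hg t₁ t₂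
    omega
  -- host: pairs t₁ @ g₁, t₂ @ g₂, and {a g₃, a g₃ + 1} or {a g₃ - 1, a g₃} @ g₃ catches b too (non-opposite values)
  have hs3 : ∃ s₃ : ZMod 4, (a g₃ = s₃ ∨ a g₃ = s₃ + 1) ∧ (b g₃ = s₃ ∨ b g₃ = s₃ + 1) := by
    have key : ∀ x y : ZMod 4, y ≠ x + 2 → ∃ s : ZMod 4, (x = s ∨ x = s + 1) ∧ (y = s ∨ y = s + 1) := by decide
    exact key _ _ hne
  obtain ⟨s₃, ha3, hb3⟩ := hs3
  obtain ⟨f₀, u, hu⟩ := boxHosted_of_three A hg (Ne.symm h31) (Ne.symm h32) (t₁ + 2) (t₂ + 2) s₃ fun c hc => by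
    by_cases c1 : c g₁ = t₁ + 2 ∨ c g₁ = t₁ + 2 + 1
    · exact Or.inl c1
    by_cases c2 : c g₂ = t₂ + 2 ∨ c g₂ = t₂ + 2 + 1
    · exact Or.inr (Or.inl c2)
    have hcb : c ∈ box A g₁ t₁ g₂ t₂ := mem_box.2 ⟨hc, (not_far_iff _ _).1 c1, (not_far_iff _ _).1 c2⟩
    rcases hbox c hcb with rfl | rfl
    · exact Or.inr (Or.inr ha3)
    · exact Or.inr (Or.inr hb3)
  exact hN f₀ u hu

/-- every point of `A` has a box partner (for any two coordinates and pairs through it). -/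
theorem exists_partner {g₁ g₂ : Fin 4} (hg : g₁ ≠ g₂) (t₁ t₂ : ZMod 4) (a : PT) :
    ∃ b ∈ box A g₁ t₁ g₂ t₂, b ≠ a := by
  by_contra hne
  push Not at hne
  have h1 : (box A g₁ t₁ g₂ t₂).card ≤ 1 := by
    rw [Finset.card_le_one]
    intro x hx y hy
    rw [hne x hx, hne y hy]
  have := card_box hA8 hN hg t₁ t₂
  omega

end structure_

end Summit.Ventures.HSemireg.PhaseTorus
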